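import Summits.CriticalPhenomena.PercolationContinuityZ3.Theorems.Transplant.KNParaChainSchedN
import Summits.CriticalPhenomena.PercolationContinuityZ3.Theorems.Transplant.SkelPhiWinChainS
import HarnessLib

/-!
# N1 (the `{±1}` node), LEVEL 1: the TARGET CHAIN OF A PLANAR SCHEDULE, typed ONCE over a route-free SCHEDULE FRAME `ChainPlanar.SchedFrame`
# (`ax lo hi region prism N R′` + `encl succ sub_prism nonempty`) — so that D″'s `Schedule` AND the N1 slab-target `ScheduleN` (and any later route
# shape) feed the SAME window chain: `stepDF/coreTF/stepLF/coreEF/stepAF`, `lhyp_stepF`, `kitsAt_stepAF`, **`lt_real_of_chainF`** — the text of p1-g9's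
# `SkelPhiWinChainS` §2–§3 with `S : Schedule ↦ S : SchedFrame` (the route property was never used there except in `roomS`), plus the N1 room `roomN`

builds on p205010 (kernel theorem, internal audit signed; external expert review pending) — nothing in this file uses p205010; nothing here is a
claim about the open node `SamePDropOfSkeletonNeg`.
Lane `prim-bschramm`, seat `prim-bschramm-p1` (gen 11; NEG-SCOPE v1.1 §5 / P5-R2; lane INBOX 2026-08-21 ≈12:05Z/12:20Z); helper file
(`--supports stmt-CriticalPhenomena-4575 --as helper`).  `Skelφ.PlanarWindow` / `planarWindowWin` / `planarWindowIn` / `WinChainData` are REUSED from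
`SkelPhiWinChainS` (structures independent of the schedule); only the `S`-parametrised definitions and lemmas are re-typed (suffix `F`), verbatim proofs.
* §1 **`ChainPlanar.SchedFrame`** (route-free schedule data), `SchedFrame.core/level`, `icc_enlarge_mono` (the level lemmas of `Schedule`/`ScheduleN` are not
  restated: the dedup lint equates structure twins), **`Schedule.toFrame`**, **`ScheduleN.toFrame`** (+ `toFrame_spec`);
* §2 `PlanarWindow.stepDF/coreTF`, `coreTF_subset_stepDF`, `stepDF_subset_prism`; `WinChainData.stepLF/coreEF/stepAF`, `stepLF_X(_zero)`, `coreTF_subset_X_zero_succ`,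
  `coreTF_subset_coreEF`, `coreEF_sdiff_subset`, `stepAF_o/_T/_D`, **`lhyp_stepF`**, `enclF`, `coreEF_subset_stepDF`, **`kitsAt_stepAF`**;
* §3 **`roomN`** (the slab-target route of a `ScheduleN` at every point of a level `j ≤ j₁ ≤ Rlev < R′` — the `hroom` of the N1 route datum) and
  **`lt_real_of_chainF`** (the chain of `S.N + 1` steps transferred by `KNLevels.lt_real_of_chain`).
[cite: KozmaNitzan2024, §4 Lemma 10 (p. 17), Lemma 11 (pp. 22–23), Lemma 12 (pp. 23–25)] [cite: MartineauTassion2017, §4.3 Lemma 4.2]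
-/

noncomputable section

open MeasureTheory ProbabilityTheory
open scoped ENNReal

namespace Summit.CriticalPhenomena.PercolationContinuityZ3.Theorems.Transplant

/-! ## §1 Route-free schedule frames -/

namespace ChainPlanar

open Literature.Probability.Percolation Literature.Probability.LatticeModels
open Literature.Probability.Percolation.KozmaNitzan.Cells (oth)

/-- **A route-free planar schedule frame of `N + 1` steps**: cores `Icc (lo k) (hi k)`, regions, one prism, axis per step, the neighbourhood radius
`R'`, and the three containments + nonemptiness (everything the window chain reads; no route property). [cite: KozmaNitzan2024, §4 Lemma 11 (pp. 22–23), Lemma 12] -/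
structure SchedFrame where
  /-- the axis of step `k` -/
  ax : ℕ → Fin 2
  /-- lower corner of core `k` -/
  lo : ℕ → Site 2
  /-- upper corner of core `k` -/
  hi : ℕ → Site 2
  /-- the region of step `k` -/
  region : ℕ → Finset (Site 2)
  /-- one planar box holding every region -/
  prism : Finset (Site 2)
  /-- the steps are `0, …, N` -/
  N : ℕ
  /-- the planar neighbourhood radius -/
  R' : ℕ
  /-- the `R'`-enlarged core lies in the region -/
  encl : ∀ k ≤ N, Finset.Icc (lo k - ((R' : ℕ) : Site 2)) (hi k + ((R' : ℕ) : Site 2)) ⊆ region k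
  /-- the next core lies in the region -/
  succ : ∀ k ≤ N, Finset.Icc (lo (k + 1)) (hi (k + 1)) ⊆ region k
  /-- every region lies in the prism -/
  sub_prism : ∀ k ≤ N, region k ⊆ prism
  /-- every core is nonempty -/
  nonempty : ∀ k ≤ N + 1, (Finset.Icc (lo k) (hi k)).Nonempty

namespace SchedFrame

variable (S : SchedFrame)

/-- Core `k` of the frame. [folklore] -/
def core (k : ℕ) : Finset (Site 2) := Finset.Icc (S.lo k) (S.hi k)

/-- Level `j` of step `k`: the `j`-enlargement of core `k`. [cite: KozmaNitzan2024, §4 p. 15 (B⟨j⟩)] -/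
def level (k j : ℕ) : Finset (Site 2) := Finset.Icc (S.lo k - ((j : ℕ) : Site 2)) (S.hi k + ((j : ℕ) : Site 2))

/-- Enlarged core boxes of a frame grow with the enlargement (both sides unfolded — the `Schedule`/`ScheduleN` twins state this with `level`). [folklore] -/
theorem icc_enlarge_mono (k : ℕ) {j j' : ℕ} (h : j ≤ j') :
    Finset.Icc (S.lo k - ((j : ℕ) : Site 2)) (S.hi k + ((j : ℕ) : Site 2)) ⊆ Finset.Icc (S.lo k - ((j' : ℕ) : Site 2)) (S.hi k + ((j' : ℕ) : Site 2)) := by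
  refine Finset.Icc_subset_Icc (fun i => ?_) (fun i => ?_) <;>
    simp only [Pi.sub_apply, Pi.add_apply, Pi.natCast_apply] <;> omega

end SchedFrame

/-- **The frame of a D″ schedule** (forget the band route). [folklore] -/
def Schedule.toFrame (S : Schedule) : SchedFrame :=
  ⟨S.ax, S.lo, S.hi, S.region, S.prism, S.N, S.R', S.encl, S.succ, S.sub_prism, S.nonempty⟩

/-- **The frame of an N1 schedule** (forget the slab-target route). [folklore] -/
def ScheduleN.toFrame (S : ScheduleN) : SchedFrame :=
  ⟨S.ax, S.lo, S.hi, S.region, S.prism, S.N, S.R', S.encl, S.succ, S.sub_prism, S.nonempty⟩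

/-- The frame of a D″ schedule, field by field. [folklore] -/
theorem Schedule.toFrame_spec (S : Schedule) : S.toFrame.ax = S.ax ∧ S.toFrame.lo = S.lo ∧ S.toFrame.hi = S.hi ∧ S.toFrame.region = S.region ∧
    S.toFrame.prism = S.prism ∧ S.toFrame.N = S.N ∧ S.toFrame.R' = S.R' ∧ (∀ k, S.toFrame.core k = S.core k) ∧ ∀ k j, S.toFrame.level k j = S.level k j :=
  ⟨rfl, rfl, rfl, rfl, rfl, rfl, rfl, fun _ => rfl, fun _ _ => rfl⟩

/-- The frame of an N1 schedule, field by field. [folklore] -/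
theorem ScheduleN.toFrame_spec (S : ScheduleN) : S.toFrame.ax = S.ax ∧ S.toFrame.lo = S.lo ∧ S.toFrame.hi = S.hi ∧ S.toFrame.region = S.region ∧
    S.toFrame.prism = S.prism ∧ S.toFrame.N = S.N ∧ S.toFrame.R' = S.R' ∧ (∀ k, S.toFrame.core k = S.core k) ∧ ∀ k j, S.toFrame.level k j = S.level k j :=
  ⟨rfl, rfl, rfl, rfl, rfl, rfl, rfl, fun _ => rfl, fun _ _ => rfl⟩

end ChainPlanar

/-! ## §2 The chain of a schedule frame as target steps -/

namespace Skelφ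

open Literature.Probability.Percolation Literature.Probability.LatticeModels SimpleGraph
open Literature.Probability.Percolation.KozmaNitzan
open Literature.Probability.Percolation.KozmaNitzan.Cells (oth)
open KNLevels ChainPlanar
open Skel (winGraph winGraphIn)

variable {V : Type} [DecidableEq V]

namespace PlanarWindow

variable {G' : SimpleGraph V} [G'.LocallyFinite] (𝒲 : PlanarWindow G') (S : SchedFrame)

/-- **The region of step `k`**: the window over `S.region k`. [cite: KozmaNitzan2024, §4 Lemma 11 (p. 22: the slabs of Ω)] -/
def stepDF (k : ℕ) : Finset V := 𝒲.W (S.region k)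

/-- **The true target of step `k`**: the window over the NEXT core, `= X^{(k+1)}_0`. [cite: KozmaNitzan2024, §4 Lemma 12] -/
def coreTF (k : ℕ) : Finset V := 𝒲.W (S.core (k + 1))

/-- **`T'_k ⊆ D_k`** (`k ≤ N`). [folklore] -/
theorem coreTF_subset_stepDF {k : ℕ} (hk : k ≤ S.N) : 𝒲.coreTF S k ⊆ 𝒲.stepDF S k := 𝒲.mono (S.succ _ hk)

/-- **`D_k` lies in the prism window** `W S.prism`. [cite: KozmaNitzan2024, §4 Lemma 11 (p. 22: Ω)] -/
theorem stepDF_subset_prism {k : ℕ} (hk : k ≤ S.N) : 𝒲.stepDF S k ⊆ 𝒲.W S.prism := 𝒲.mono (S.sub_prism k hk)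

end PlanarWindow

namespace WinChainData

variable {G' : SimpleGraph V} [G'.LocallyFinite] (P : WinChainData V) (𝒲 : PlanarWindow G') (S : SchedFrame)

/-- **The levels of step `k`**: `X_j = W (S.level k j)`, source `o`, support `Sfin`. [cite: KozmaNitzan2024, §4 p. 15 (B⟨j⟩), Lemma 10] -/
def stepLF (k : ℕ) : LData G' := ⟨fun j => 𝒲.W (S.level k j), P.o, P.Sfin⟩

/-- **The enlarged target of step `k`**: true target ∪ rim part. [cite: KozmaNitzan2024, §4 p. 20 (Step IV)] -/
def coreEF (k : ℕ) : Finset V := 𝒲.coreTF S k ∪ P.Rim k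

/-- **Step `k` of the chain as a target step** in `G'`. [cite: KozmaNitzan2024, §4 Lemma 12] -/
def stepAF (k : ℕ) : TStep G' := ⟨P.stepLF 𝒲 S k, 𝒲.stepDF S k, P.coreEF 𝒲 S k, P.Rlev, P.N, P.j₀, P.j₁⟩

/-! ### The levels, the link, the containments -/

/-- The levels of step `k`, unfolded. [folklore] -/
theorem stepLF_X (k j : ℕ) : (P.stepLF 𝒲 S k).X j = 𝒲.W (S.level k j) := rfl

/-- The first level of step `k` is `W (core k)`. [folklore] -/
theorem stepLF_X_zero (k : ℕ) : (P.stepLF 𝒲 S k).X 0 = 𝒲.W (S.core k) := by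
  rw [stepLF_X]; simp [SchedFrame.level, SchedFrame.core]

/-- **The true targets link the chain**: `T'_k ⊆ X^{(k+1)}_0` (indeed equal). [cite: KozmaNitzan2024, §4 Lemma 12] -/
theorem coreTF_subset_X_zero_succ (k : ℕ) : 𝒲.coreTF S k ⊆ (P.stepAF 𝒲 S (k + 1)).L.X 0 := by
  show 𝒲.coreTF S k ⊆ (P.stepLF 𝒲 S (k + 1)).X 0
  rw [P.stepLF_X_zero 𝒲 S]; exact subset_rfl

/-- The true target lies in the enlarged target. [folklore] -/
theorem coreTF_subset_coreEF (k : ℕ) : 𝒲.coreTF S k ⊆ (P.stepAF 𝒲 S k).T := Finset.subset_union_left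

/-- The excess part of the enlarged target is inside the rim part. [folklore] -/
theorem coreEF_sdiff_subset (k : ℕ) : (P.stepAF 𝒲 S k).T \ 𝒲.coreTF S k ⊆ P.Rim k := by
  intro v hv
  rw [Finset.mem_sdiff] at hv
  rcases Finset.mem_union.1 hv.1 with h | h
  · exact absurd h hv.2
  · exact h

/-- The sources agree. [folklore] -/
theorem stepAF_o (k : ℕ) : (P.stepAF 𝒲 S k).L.o = P.o := rfl

/-- The targets. [folklore] -/
theorem stepAF_T (k : ℕ) : (P.stepAF 𝒲 S k).T = P.coreEF 𝒲 S k := rfl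

/-- The regions. [folklore] -/
theorem stepAF_D (k : ℕ) : (P.stepAF 𝒲 S k).D = 𝒲.stepDF S k := rfl

/-- **The hypotheses of Lemma 10 for the levels of step `k`** from the planar window's monotonicity and nesting: a subbox `D ⊇ X_{Rl+1}` of a
finitely supported weighting and a source `o ∈ Sfin ∖ D` give `KNLevels.LHyp`. [cite: KozmaNitzan2024, §4 Lemma 10 (p. 17)] -/
theorem lhyp_stepF (k : ℕ) {Wt : Sym2 V → unitInterval} {p : unitInterval} {D : Finset V} {Rl : ℕ} (hsub : IsSubbox G' Wt p D)
    (hfin : FinSupp Wt P.Sfin) (hDS : D ⊆ P.Sfin) (hencl : (P.stepLF 𝒲 S k).X (Rl + 1) ⊆ D) (ho : P.o ∉ D) (hoS : P.o ∈ P.Sfin) :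
    LHyp (P.stepLF 𝒲 S k) Wt p D Rl where
  mono := fun _ _ h => 𝒲.mono (S.icc_enlarge_mono k h)
  nest j := by
    show outerBoundary G' (𝒲.W (Finset.Icc (S.lo k - ((j : ℕ) : Site 2)) (S.hi k + ((j : ℕ) : Site 2)))) ⊆
      𝒲.W (Finset.Icc (S.lo k - ((j + 1 : ℕ) : Site 2)) (S.hi k + ((j + 1 : ℕ) : Site 2)))
    have h := 𝒲.nest (S.lo k - ((j : ℕ) : Site 2)) (S.hi k + ((j : ℕ) : Site 2))
    have e1 : S.lo k - ((j : ℕ) : Site 2) - 1 = S.lo k - ((j + 1 : ℕ) : Site 2) := by push_cast; abel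
    have e2 : S.hi k + ((j : ℕ) : Site 2) + 1 = S.hi k + ((j + 1 : ℕ) : Site 2) := by push_cast; abel
    rw [e1, e2] at h
    exact h
  sub := hsub
  fin := hfin
  DS := hDS
  encl := hencl
  o_not := ho
  o_mem := hoS

/-- **`X^{(k)}_{Rlev+1} ⊆ D_k`** when `Rlev + 1 ≤ R'` (`k ≤ N`). [cite: KozmaNitzan2024, §4 Lemma 10 (p. 17: B⟨R+1⟩ ⊆ D)] -/
theorem enclF (hRl : P.Rlev + 1 ≤ S.R') {k : ℕ} (hk : k ≤ S.N) : (P.stepLF 𝒲 S k).X (P.Rlev + 1) ⊆ 𝒲.stepDF S k :=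
  𝒲.mono ((S.icc_enlarge_mono k hRl).trans (S.encl k hk))

/-- **`T_k ⊆ D_k`** when the rim part lies in the region. [folklore] -/
theorem coreEF_subset_stepDF (hRim : ∀ k, P.Rim k ⊆ 𝒲.stepDF S k) {k : ℕ} (hk : k ≤ S.N) : P.coreEF 𝒲 S k ⊆ 𝒲.stepDF S k :=
  Finset.union_subset (𝒲.coreTF_subset_stepDF S hk) (hRim k)

/-! ### The kits -/

/-- **`KitsAt` of the enlarged step `k`** (`k ≤ N`) from a subbox region in `G'`, finite support, the source off the region, a nonempty true
target, the count inequality and the per-level kit clause towards the enlarged target (for `G' = winGraph …` / `winGraphIn …` the clause is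
`Skelφ.kitClause'` / `kitClauseHab'`, its `hcon'` from `SkelPhiRouteDatum` + `roomS`). [cite: KozmaNitzan2024, §4 Lemma 10 (p. 17)] -/
theorem kitsAt_stepAF (hRl : P.Rlev + 1 ≤ S.R') (hRim : ∀ k, P.Rim k ⊆ 𝒲.stepDF S k) {k : ℕ} (hk : k ≤ S.N)
    (hTne : (𝒲.coreTF S k).Nonempty) {Wt : Sym2 V → unitInterval} {p : unitInterval} {Δ : ℕ} {δ : ℝ}
    (hsub : IsSubbox G' Wt p (𝒲.stepDF S k)) (hfin : FinSupp Wt P.Sfin) (hDS : 𝒲.stepDF S k ⊆ P.Sfin)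
    (ho : P.o ∉ 𝒲.stepDF S k) (hoS : P.o ∈ P.Sfin) (hj : P.j₁ ≤ P.Rlev)
    (hcount : 1 / (1 - (p : ℝ)) ^ (Δ * P.N) ≤ δ * ((Finset.Icc P.j₀ P.j₁).card : ℝ))
    (hkits : ∀ j ∈ Finset.Icc P.j₀ P.j₁, ∃ (σ : SData V) (Sz : Finset V),
      SHyp (P.stepLF 𝒲 S k) j σ ∧ σ.N ≤ P.N ∧
      (1 - (p : ℝ) ^ σ.sB) ^ σ.k ≤ δ ∧ Sz ⊆ (P.stepLF 𝒲 S k).X j ∧ Sz ⊆ 𝒲.stepDF S k ∧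
      (∀ x ∈ σ.K, ∀ e ∈ σ.seed x, e ∉ wireSet (↑Sz : Set V)) ∧ (∀ x ∈ σ.K, σ.face x ⊆ Sz) ∧
      (∀ x ∈ σ.K, 1 - 3 * δ ≤ (prodBernoulli Wt).real {ω | ∃ u ∈ σ.face x,
        1 - δ < (prodBernoulli (pinW Wt (wireSet (↑Sz : Set V)) ω)).real
          (⋃ t ∈ P.coreEF 𝒲 S k, openConnIn (↑(𝒲.stepDF S k) : Set V) u t)})) :
    (P.stepAF 𝒲 S k).KitsAt Wt p Δ δ :=
  ⟨P.lhyp_stepF 𝒲 S k hsub hfin hDS (P.enclF 𝒲 S hRl hk) ho hoS, hj, P.coreEF_subset_stepDF 𝒲 S hRim hk,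
    hTne.mono (P.coreTF_subset_coreEF 𝒲 S k), hcount, hkits⟩


/-! ## §3 The room of an N1 schedule and the transfer -/

omit [DecidableEq V] [G'.LocallyFinite] in
/-- **THE PLANAR ROOM OF THE N1 CHAIN**: for `k ≤ N`, every level `j ≤ j₁` (`j₁ ≤ Rlev`, `Rlev + 1 ≤ R'`) and every planar point `v` of the level box
`S.level k j` of an N1 schedule `S : ScheduleN`, the slab-target route at `v` (sign `σ`, link box in `S.region k`, a steered piece of the slab in
`S.core (k+1)`) — the `hroom` of the N1 route datum. [cite: MartineauTassion2017, §4.3 Lemma 4.2] [cite: KozmaNitzan2024, §4 Lemma 11 (pp. 22–23)] -/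
theorem roomN (SN : ScheduleN) (hRl : P.Rlev + 1 ≤ SN.R') (hj : P.j₁ ≤ P.Rlev) {k : ℕ} (hk : k ≤ SN.N) :
    ∀ j, j ≤ P.j₁ → ∀ v ∈ SN.level k j, ∃ σ : ℤ, (σ = 1 ∨ σ = -1) ∧
      (∀ y : Site 2, |y (SN.ax k) - v (SN.ax k)| ≤ SN.La k → |y (oth (SN.ax k)) - v (oth (SN.ax k))| ≤ SN.Lb k → y ∈ SN.region k) ∧
      ∃ τ : ℤ, (τ = 1 ∨ τ = -1) ∧ ∀ y : Site 2, SN.sLo k ≤ σ * (y (SN.ax k) - v (SN.ax k)) → σ * (y (SN.ax k) - v (SN.ax k)) ≤ SN.sHi k →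
        SN.InPiece k τ (σ * (y (oth (SN.ax k)) - v (oth (SN.ax k))) - SN.d k) → y ∈ SN.core (k + 1) :=
  fun _ hjj _ hv => SN.route_level hk ((hjj.trans hj).trans (by omega)) hv

/-- **THE CHAIN TRANSFERRED**: the chain of `S.N + 1` steps in the exploration graph `G'` under a weighting `W'` with per-step facts, nonempty
true targets, rim excess `≤ η ≤ δ/2`, a chain property of length `S.N + 1` at `(δ ↦ ε'')`, a source bound towards `B₀ ⊆ X^{(0)}_0`, the last core
inside `Ft` and `P_{W'}(⋃ t ∈ Ft, o ↔ t) ≤ μA` give `1 − ε'' < μA` (the root chain, the elongated deep routes of the face-step contacts, the corridor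
chains). [cite: KozmaNitzan2024, §4 Lemma 11 (pp. 22–23), Lemma 12 (pp. 23–25), p. 20 (Step IV)] -/
theorem lt_real_of_chainF (hRl : P.Rlev + 1 ≤ S.R') (hRim : ∀ k, P.Rim k ⊆ 𝒲.stepDF S k)
    (hTne : ∀ k ≤ S.N, (𝒲.coreTF S k).Nonempty)
    {p : unitInterval} {W' : Sym2 V → unitInterval} {Ft B₀ : Finset V} {μA : ℝ} {Δ' : ℕ} {δ ε'' η : ℝ}
    (hchain : ∀ (Wg : Sym2 V → unitInterval) (s : Fin (S.N + 1) → TStep G')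
      (T' : Fin (S.N + 1) → Finset V) (η : ℝ),
      (∀ i, (s i).L.o = (s 0).L.o) →
      (∀ i : Fin S.N, T' (Fin.castSucc i) ⊆ (s i.succ).L.X 0) →
      (∀ i, T' i ⊆ (s i).T) →
      (∀ i, (s i).KitsAt Wg p Δ' δ) →
      η ≤ δ / 2 →
      (∀ i, (prodBernoulli Wg).real (⋃ t ∈ (s i).T \ T' i, openConn (s 0).L.o t) ≤ η) →
      1 - δ < (prodBernoulli Wg).real (s 0).L.reachB →
        1 - ε'' < (prodBernoulli Wg).real (⋃ t ∈ T' (Fin.last S.N), openConn (s 0).L.o t))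
    (hsub : ∀ k ≤ S.N, IsSubbox G' W' p (𝒲.stepDF S k)) (hfin : FinSupp W' P.Sfin)
    (hDS : ∀ k ≤ S.N, 𝒲.stepDF S k ⊆ P.Sfin) (ho : ∀ k ≤ S.N, P.o ∉ 𝒲.stepDF S k) (hoS : P.o ∈ P.Sfin) (hj : P.j₁ ≤ P.Rlev)
    (hcount : 1 / (1 - (p : ℝ)) ^ (Δ' * P.N) ≤ δ * ((Finset.Icc P.j₀ P.j₁).card : ℝ))
    (hkits : ∀ k ≤ S.N, ∀ j ∈ Finset.Icc P.j₀ P.j₁, ∃ (σ : SData V) (Sz : Finset V),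
      SHyp (P.stepLF 𝒲 S k) j σ ∧ σ.N ≤ P.N ∧
      (1 - (p : ℝ) ^ σ.sB) ^ σ.k ≤ δ ∧ Sz ⊆ (P.stepLF 𝒲 S k).X j ∧ Sz ⊆ 𝒲.stepDF S k ∧
      (∀ x ∈ σ.K, ∀ e ∈ σ.seed x, e ∉ wireSet (↑Sz : Set V)) ∧ (∀ x ∈ σ.K, σ.face x ⊆ Sz) ∧
      (∀ x ∈ σ.K, 1 - 3 * δ ≤ (prodBernoulli W').real {ω | ∃ u ∈ σ.face x,
        1 - δ < (prodBernoulli (pinW W' (wireSet (↑Sz : Set V)) ω)).real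
          (⋃ t ∈ P.coreEF 𝒲 S k, openConnIn (↑(𝒲.stepDF S k) : Set V) u t)}))
    (hη : η ≤ δ / 2) (hexc : ∀ k ≤ S.N, (prodBernoulli W').real (⋃ t ∈ P.Rim k, openConn P.o t) ≤ η)
    (hB₀ : B₀ ⊆ (P.stepLF 𝒲 S 0).X 0) (hsrc : 1 - δ < (prodBernoulli W').real (⋃ t ∈ B₀, openConn P.o t))
    (hTn : 𝒲.coreTF S S.N ⊆ Ft) (hdom : (prodBernoulli W').real (⋃ t ∈ Ft, openConn P.o t) ≤ μA) :
    1 - ε'' < μA := by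
  let s : Fin (S.N + 1) → TStep G' := fun i => P.stepAF 𝒲 S i
  let T' : Fin (S.N + 1) → Finset V := fun i => 𝒲.coreTF S i
  have hle : ∀ i : Fin (S.N + 1), (i : ℕ) ≤ S.N := fun i => Nat.lt_succ_iff.1 i.2
  refine lt_real_of_chain G' hchain s T' (fun i => P.stepAF_o 𝒲 S i) (fun i => ?_) (fun i => P.coreTF_subset_coreEF 𝒲 S i)
    (fun i => ?_) hη (fun i => ?_) ?_ ?_ hdom
  · -- the true targets link the chain
    show 𝒲.coreTF S (Fin.castSucc i) ⊆ (P.stepAF 𝒲 S i.succ).L.X 0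
    have : ((i.succ : Fin (S.N + 1)) : ℕ) = (Fin.castSucc i : ℕ) + 1 := by simp
    rw [show P.stepAF 𝒲 S (i.succ : ℕ) = P.stepAF 𝒲 S ((Fin.castSucc i : ℕ) + 1) by rw [this]]
    exact P.coreTF_subset_X_zero_succ 𝒲 S _
  · exact P.kitsAt_stepAF 𝒲 S hRl hRim (hle i) (hTne i (hle i)) (hsub i (hle i)) hfin (hDS i (hle i)) (ho i (hle i)) hoS hj hcount
      (hkits i (hle i))
  · -- the excess of the enlarged target is inside the rim part
    refine le_trans (measureReal_mono ?_ (measure_ne_top _ _)) (hexc i (hle i))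
    intro ω hω
    simp only [Set.mem_iUnion, exists_prop] at hω ⊢
    obtain ⟨t, ht, hωt⟩ := hω
    exact ⟨t, P.coreEF_sdiff_subset 𝒲 S i ht, hωt⟩
  · -- the source bound: `B₀ ⊆ X^{(0)}_0`
    show 1 - δ < (prodBernoulli W').real (P.stepAF 𝒲 S ((0 : Fin (S.N + 1)) : ℕ)).L.reachB
    rw [Fin.val_zero]
    refine hsrc.trans_le (measureReal_mono ?_ (measure_ne_top _ _))
    intro ω hω
    simp only [Set.mem_iUnion, exists_prop] at hω
    obtain ⟨t, ht, hωt⟩ := hω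
    show ω ∈ (P.stepLF 𝒲 S 0).reachB
    exact Set.mem_biUnion (Finset.mem_coe.2 (hB₀ ht)) hωt
  · -- the last core lies in `Ft`
    show 𝒲.coreTF S ((Fin.last S.N : Fin (S.N + 1)) : ℕ) ⊆ Ft
    rw [Fin.val_last]; exact hTn

end WinChainData

end Skelφ

end Summit.CriticalPhenomena.PercolationContinuityZ3.Theorems.Transplant

end
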